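import Literature.NumberTheory.EllipticCurves.NeronSigmaFunction
import Literature.NumberTheory.EllipticCurves.WeierstrassZetaLegendre
import Literature.NumberTheory.EllipticCurves.WeierstrassSigmaProofs
import Literature.NumberTheory.EllipticCurves.WeierstrassTorsion
import Literature.NumberTheory.EllipticCurves.LatticeJInvariant
import Mathlib.Analysis.SpecialFunctions.Log.PosLog
import HarnessLib

/-!
# The Néron function in `σ`-form: homothety, periodicity, duplication law and boundedness (proved)

Topic `NumberTheory/EllipticCurves` (family `abc`, G06). Pure proofs (theorems only), companion
of `NeronSigmaFunction.lean` (Silverman, *Advanced Topics*, Prop. VI.3.1 and Thm. VI.3.2). This is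
the analytic package needed to identify Tate's series on `E(ℂ)` with `PeriodPair.neronSigma`
(ATAEC Thm. VI.3.2, the remaining half of the decomposition of the named fact
`Literature.NumberTheory.EllipticCurves.neronLocalHeight_eq_neronFunction`, VI.3.4(b)) by Tate's
uniqueness argument (bounded + duplication law ⇒ equal):

* **homothety** `Λ ↦ cΛ`: `σ(cz; cΛ) = cσ(z; Λ)`, `ζ(cz; cΛ) = c⁻¹ζ(z; Λ)`, `ηᵢ(cΛ) = c⁻¹ηᵢ`,
  `η_{cΛ}(cz) = c⁻¹η(z)` and hence `neronSigma_mulLeft`: `λ_{cΛ}(cz) = λ_Λ(z)` (`z ∉ Λ`);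
* **Prop. VI.3.1(a)** `re_mul_quasiPeriodMap_sub`: `Re(zη(w) − wη(z)) = 0` (Legendre's relation,
  the tree's `PeriodPair.legendre_relation_up_to_sign`);
* **Prop. VI.3.1(b)–(c)** `norm_weierstrassSigma_add_of_mem`: `|σ(z + ω)| = e^{Re(η(ω)(z + ω/2))}|σ(z)|`
  for every `ω ∈ Λ` (iterating the tree's discharged quasi-periodicity
  `weierstrassSigma_add_ω₁/ω₂_holds`), and `neronSigma_add_of_mem`: `λ(z + ω) = λ(z)` off `Λ`;
* **the duplication law** `neronSigma_two_mul`: `λ(2z) = 4λ(z) − log|℘'(z)| + ¼log|Δ(Λ)|`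
  (`2z ∉ Λ`) — property (iii) of Thm. VI.1.1 in the proof of Thm. VI.3.2 — from Prop. I.5.6(b)
  `℘'(z) = −σ(2z)/σ(z)⁴`, which is the tree's `PeriodPair.derivWeierstrassP_eq_sigma`
  (`WeierstrassTorsion.lean`); and `tendsto_weierstrassSigma_div`: `σ(h)/h → 1`;
* **boundedness** `exists_bound_posLog_sub_neronSigma`: for every `b ∈ ℂ`,
  `½ log⁺|℘(w) − b| − λ(w)` is bounded on `ℂ ∖ Λ` — properties (i)–(ii) of Thm. VI.1.1 for `λ` with
  `x = ℘ − b` (near lattice points `℘ = w⁻² + O(1)`, `σ(w)/w → 1`; elsewhere continuity on a compact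
  fundamental domain and periodicity), together with `continuousAt_neronSigma`.

## References

* J. H. Silverman, *Advanced Topics in the Arithmetic of Elliptic Curves* (1994), Prop. I.5.4,
  Prop. I.5.6, Thm. VI.1.1, Prop. VI.3.1, Thm. VI.3.2 and its proof (pp. 465–466).
* E. T. Whittaker, G. N. Watson, *A Course of Modern Analysis*, 4th ed., §20.42, §20.421.
-/

noncomputable section

open scoped Real Topology

open Complex


namespace PeriodPair

variable (L : PeriodPair)

/-! ### Homothety `Λ ↦ cΛ` -/

section MulLeft

variable {c : ℂ} (hc : c ≠ 0)
include hc

/-- The Weierstrass factor is homogeneous of degree `0`: `E(cz, cl) = E(z, l)` (`c ≠ 0`). [folklore] -/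
theorem sigmaFactor_mul_mul (z l : ℂ) : sigmaFactor (c * z) (c * l) = sigmaFactor z l := by
  by_cases hl : l = 0
  · simp [hl]
  · unfold sigmaFactor
    have h1 : c * z / (c * l) = z / l := mul_div_mul_left z l hc
    have h2 : (c * z) ^ 2 / (2 * (c * l) ^ 2) = z ^ 2 / (2 * l ^ 2) := by
      rw [mul_pow, mul_pow, mul_left_comm, mul_div_mul_left _ _ (pow_ne_zero 2 hc)]
    rw [h1, h2]

/-- `σ(cz; cΛ) = c σ(z; Λ)`: `σ` is homogeneous of degree `1` in `(z, Λ)` (Whittaker–Watson §20.42,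
reindexing the product over `cΛ`). [folklore] -/
theorem weierstrassSigma_mulLeft (z : ℂ) :
    (L.mulLeft c hc).weierstrassSigma (c * z) = c * L.weierstrassSigma z := by
  unfold weierstrassSigma
  rw [← (latticeMulLeftEquiv c hc L).tprod_eq]
  simp only [coe_latticeMulLeftEquiv, sigmaFactor_mul_mul hc]
  ring

/-- `ζ(cz; cΛ) = c⁻¹ ζ(z; Λ)`: `ζ` is homogeneous of degree `−1` (reindexing the sum over `cΛ`).
[folklore] -/
theorem weierstrassZeta_mulLeft (z : ℂ) :
    (L.mulLeft c hc).weierstrassZeta (c * z) = c⁻¹ * L.weierstrassZeta z := by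
  unfold weierstrassZeta
  rw [← (latticeMulLeftEquiv c hc L).tsum_eq, ← tsum_mul_left]
  refine tsum_congr fun l => ?_
  simp only [coe_latticeMulLeftEquiv]
  rcases eq_or_ne (l : ℂ) 0 with hl | hl
  · rw [hl]
    simp [mul_comm]
  · rw [← mul_sub, mul_pow]
    field_simp

/-- `η₁(cΛ) = c⁻¹ η₁(Λ)` (the quasi-periods are homogeneous of degree `−1`). [folklore] -/
theorem η₁_mulLeft : (L.mulLeft c hc).η₁ = c⁻¹ * L.η₁ := by
  rw [η₁, η₁, mulLeft_ω₁, show c * L.ω₁ / 2 = c * (L.ω₁ / 2) by ring, L.weierstrassZeta_mulLeft hc]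
  ring

/-- `η₂(cΛ) = c⁻¹ η₂(Λ)`. [folklore] -/
theorem η₂_mulLeft : (L.mulLeft c hc).η₂ = c⁻¹ * L.η₂ := by
  rw [η₂, η₂, mulLeft_ω₂, show c * L.ω₂ / 2 = c * (L.ω₂ / 2) by ring, L.weierstrassZeta_mulLeft hc]
  ring

/-- `η_{cΛ}(cz) = c⁻¹ η_Λ(z)` for the `ℝ`-linear quasi-period maps (both sides are `ℝ`-linear in `z`
and agree on the basis `ω₁, ω₂`). [folklore] -/
theorem quasiPeriodMap_mulLeft (z : ℂ) :
    (L.mulLeft c hc).quasiPeriodMap (c * z) = c⁻¹ * L.quasiPeriodMap z := by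
  -- both sides are `ℝ`-linear in `z` and agree on the basis `ω₁, ω₂`
  set f : ℂ →ₗ[ℝ] ℂ := (L.mulLeft c hc).quasiPeriodMap.comp (LinearMap.mulLeft ℝ c) with hf
  set g : ℂ →ₗ[ℝ] ℂ := (LinearMap.mulLeft ℝ c⁻¹).comp L.quasiPeriodMap with hg
  have hfg : f = g := by
    apply L.basis.ext
    intro i
    simp only [hf, hg, LinearMap.comp_apply, LinearMap.mulLeft_apply]
    fin_cases i
    · simp only [Fin.zero_eta, basis_zero]
      rw [show c * L.ω₁ = (L.mulLeft c hc).ω₁ from (mulLeft_ω₁ c hc L).symm, quasiPeriodMap_ω₁,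
        quasiPeriodMap_ω₁, L.η₁_mulLeft hc]
    · simp only [Fin.mk_one, basis_one]
      rw [show c * L.ω₂ = (L.mulLeft c hc).ω₂ from (mulLeft_ω₂ c hc L).symm, quasiPeriodMap_ω₂,
        quasiPeriodMap_ω₂, L.η₂_mulLeft hc]
  have := LinearMap.congr_fun hfg z
  simpa [hf, hg, LinearMap.mulLeft_apply] using this

/-- **Homothety invariance of the Néron function**: `λ_{cΛ}(cz) = λ_Λ(z)` for `z ∉ Λ`
(the three terms change by `0`, `−log|c|`, `+log|c|`; this is why ATAEC VI.3.2/VI.3.4 may speak of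
"the" lattice of `E/ℂ` up to homothety). On the lattice the two junk values differ by `log|c|`, so
`z ∉ Λ` is needed. [cite: Silverman1994, Thm VI.3.2] -/
theorem neronSigma_mulLeft {z : ℂ} (hz : z ∉ L.lattice) :
    (L.mulLeft c hc).neronSigma (c * z) = L.neronSigma z := by
  have hσ : L.weierstrassSigma z ≠ 0 := L.weierstrassSigma_ne_zero hz
  have hc0 : ‖c‖ ≠ 0 := norm_ne_zero_iff.mpr hc
  rw [neronSigma_def, neronSigma_def, L.weierstrassSigma_mulLeft hc, L.quasiPeriodMap_mulLeft hc,
    discr_mulLeft, norm_mul, norm_mul, norm_inv, norm_pow,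
    Real.log_mul hc0 (norm_ne_zero_iff.mpr hσ),
    Real.log_mul (inv_ne_zero (pow_ne_zero _ hc0)) (norm_ne_zero_iff.mpr L.discr_ne_zero),
    Real.log_inv, Real.log_pow]
  have : c * z * (c⁻¹ * L.quasiPeriodMap z) = z * L.quasiPeriodMap z := by
    field_simp
  rw [this]
  push_cast
  ring

end MulLeft

/-! ### Prop. VI.3.1(a): `z η(w) − w η(z)` is purely imaginary -/

/-- Coordinates: `z = a ω₁ + b ω₂` with `(a, b) = L.basis.repr z`. [folklore] -/
theorem eq_repr_mul_add_repr_mul (z : ℂ) :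
    z = ((L.basis.repr z 0 : ℝ) : ℂ) * L.ω₁ + ((L.basis.repr z 1 : ℝ) : ℂ) * L.ω₂ := by
  have h := L.basis.sum_repr z
  rw [Fin.sum_univ_two, basis_zero, basis_one, Complex.real_smul, Complex.real_smul] at h
  exact h.symm

/-- `η(z) = a η₁ + b η₂` with `(a, b) = L.basis.repr z`. [cite: Silverman1994, Prop VI.3.1] -/
theorem quasiPeriodMap_eq_repr (z : ℂ) :
    L.quasiPeriodMap z = ((L.basis.repr z 0 : ℝ) : ℂ) * L.η₁ + ((L.basis.repr z 1 : ℝ) : ℂ) * L.η₂ := by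
  conv_lhs => rw [L.eq_repr_mul_add_repr_mul z]
  exact L.quasiPeriodMap_smul_add_smul _ _

/-- **ATAEC Prop. VI.3.1(a)**: for all `z, w ∈ ℂ` the quantity `z η(w) − w η(z)` is purely
imaginary; indeed `= (ad − bc)(ω₁η₂ − ω₂η₁) = ±(ad − bc) 2πi` by Legendre's relation (the tree's
`PeriodPair.legendre_relation_up_to_sign`). [cite: Silverman1994, Prop VI.3.1] -/
theorem re_mul_quasiPeriodMap_sub (z w : ℂ) :
    (z * L.quasiPeriodMap w - w * L.quasiPeriodMap z).re = 0 := by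
  have key : ∀ (Z W : ℂ) (a b c d : ℝ), Z = a * L.ω₁ + b * L.ω₂ → W = c * L.ω₁ + d * L.ω₂ →
      Z * (c * L.η₁ + d * L.η₂) - W * (a * L.η₁ + b * L.η₂) =
        ((a * d - b * c : ℝ) : ℂ) * (L.ω₁ * L.η₂ - L.ω₂ * L.η₁) := by
    rintro Z W a b c d rfl rfl
    push_cast
    ring
  rw [L.quasiPeriodMap_eq_repr z, L.quasiPeriodMap_eq_repr w,
    key z w _ _ _ _ (L.eq_repr_mul_add_repr_mul z) (L.eq_repr_mul_add_repr_mul w), Complex.re_ofReal_mul]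
  rcases L.legendre_relation_up_to_sign with h | h
  · have : L.ω₁ * L.η₂ - L.ω₂ * L.η₁ = -(2 * Real.pi * I) := by linear_combination -h
    rw [this]
    simp
  · have : L.ω₁ * L.η₂ - L.ω₂ * L.η₁ = 2 * Real.pi * I := by linear_combination h
    rw [this]
    simp

/-! ### Quasi-periodicity of `|σ|` under a general period (ATAEC I.5.4 / Prop. VI.3.1(b)) -/

/-- Integer iterate of the one-period quasi-periodicity, in absolute value: if
`σ(z + ω) = −e^{η(z + ω/2)}σ(z)` for all `z` then `|σ(z + kω)| = e^{Re(η(kz + k²ω/2))}|σ(z)|` for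
every `k ∈ ℤ` (the tree's `norm_weierstrassSigma_add_nat_mul` for `k ≥ 0`, applied at `z + kω` for
`k < 0`). [cite: WhittakerWatson1927, §20.421] -/
theorem norm_weierstrassSigma_add_int_mul {ω η : ℂ}
    (hq : ∀ z : ℂ, L.weierstrassSigma (z + ω) = -cexp (η * (z + ω / 2)) * L.weierstrassSigma z)
    (k : ℤ) (z : ℂ) :
    ‖L.weierstrassSigma (z + k * ω)‖ =
      Real.exp ((η * (k * z + k ^ 2 * ω / 2)).re) * ‖L.weierstrassSigma z‖ := by
  obtain ⟨n, rfl | rfl⟩ := Int.eq_nat_or_neg k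
  · exact_mod_cast L.norm_weierstrassSigma_add_nat_mul hq n z
  · have h := L.norm_weierstrassSigma_add_nat_mul hq n (z + (-(n : ℤ) : ℤ) * ω)
    have e1 : z + ((-(n : ℤ) : ℤ) : ℂ) * ω + (n : ℂ) * ω = z := by push_cast; ring
    rw [e1] at h
    have e2 : (η * (n * (z + ((-(n : ℤ) : ℤ) : ℂ) * ω) + (n : ℂ) ^ 2 * ω / 2)).re =
        -(η * (((-(n : ℤ) : ℤ) : ℂ) * z + ((-(n : ℤ) : ℤ) : ℂ) ^ 2 * ω / 2)).re := by
      rw [← Complex.neg_re]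
      congr 1
      push_cast
      ring
    rw [e2, Real.exp_neg] at h
    rw [h, ← mul_assoc, mul_inv_cancel₀ (Real.exp_pos _).ne', one_mul]

/-- **Quasi-periodicity of `|σ|` under a general period**: for `ω ∈ Λ`,
`|σ(z + ω)| = e^{Re(η(ω)(z + ω/2))} |σ(z)|` (ATAEC I.5.4 / Prop. VI.3.1(b) in absolute value:
iterate Whittaker–Watson §20.421 along `ω₁` and `ω₂`; the exponents differ from `η(ω)(z + ω/2)`,
`ω = mω₁ + nω₂`, by the purely imaginary `(mn/2)(η₁ω₂ − η₂ω₁) = ±mnπi`, Legendre).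
[cite: Silverman1994, Prop VI.3.1] -/
theorem norm_weierstrassSigma_add_of_mem {ω : ℂ} (hω : ω ∈ L.lattice) (z : ℂ) :
    ‖L.weierstrassSigma (z + ω)‖ =
      Real.exp ((L.quasiPeriodMap ω * (z + ω / 2)).re) * ‖L.weierstrassSigma z‖ := by
  obtain ⟨m, n, rfl⟩ := mem_lattice.mp hω
  have h1 := L.norm_weierstrassSigma_add_int_mul L.weierstrassSigma_add_ω₁_holds m z
  have h2 := L.norm_weierstrassSigma_add_int_mul L.weierstrassSigma_add_ω₂_holds n (z + m * L.ω₁)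
  rw [show z + (m * L.ω₁ + n * L.ω₂) = z + m * L.ω₁ + n * L.ω₂ by ring, h2, h1, ← mul_assoc,
    ← Real.exp_add, ← Complex.add_re]
  congr 2
  -- the two exponents differ by the purely imaginary `(mn/2)(η₁ω₂ − η₂ω₁)`
  have hη : L.quasiPeriodMap (m * L.ω₁ + n * L.ω₂) = m * L.η₁ + n * L.η₂ := by
    have := L.quasiPeriodMap_smul_add_smul m n
    push_cast at this
    exact this
  rw [hη]
  have key : L.η₂ * (n * (z + m * L.ω₁) + (n : ℂ) ^ 2 * L.ω₂ / 2) + L.η₁ * (m * z + (m : ℂ) ^ 2 * L.ω₁ / 2) =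
      (m * L.η₁ + n * L.η₂) * (z + (m * L.ω₁ + n * L.ω₂) / 2) -
        ((m * n / 2 : ℝ) : ℂ) * (L.η₁ * L.ω₂ - L.η₂ * L.ω₁) := by
    push_cast
    ring
  rw [key, Complex.sub_re, Complex.re_ofReal_mul]
  rcases L.legendre_relation_up_to_sign with h | h
  · rw [h]
    simp
  · have : L.η₁ * L.ω₂ - L.η₂ * L.ω₁ = -(2 * Real.pi * I) := by linear_combination -h
    rw [this]
    simp

/-- **The Néron function is `Λ`-periodic** (ATAEC Prop. VI.3.1(c): `|e^{−½zη(z)}σ(z)|` is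
well defined on `ℂ/Λ`), off the lattice: `λ(z + ω) = λ(z)` for `ω ∈ Λ`, `z ∉ Λ`.
[cite: Silverman1994, Prop VI.3.1] -/
theorem neronSigma_add_of_mem {ω : ℂ} (hω : ω ∈ L.lattice) {z : ℂ} (hz : z ∉ L.lattice) :
    L.neronSigma (z + ω) = L.neronSigma z := by
  have hzω : z + ω ∉ L.lattice := fun h => hz (by simpa using sub_mem h hω)
  have hσ : ‖L.weierstrassSigma z‖ ≠ 0 := norm_ne_zero_iff.mpr (L.weierstrassSigma_ne_zero hz)
  rw [neronSigma_def, neronSigma_def, L.norm_weierstrassSigma_add_of_mem hω,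
    Real.log_mul (Real.exp_pos _).ne' hσ, Real.log_exp]
  have h31 := L.re_mul_quasiPeriodMap_sub z ω
  rw [Complex.sub_re] at h31
  have hexp : ((z + ω) * L.quasiPeriodMap (z + ω)).re =
      (z * L.quasiPeriodMap z).re + (z * L.quasiPeriodMap ω).re + (ω * L.quasiPeriodMap z).re +
        (ω * L.quasiPeriodMap ω).re := by
    rw [map_add]
    simp only [add_mul, mul_add, Complex.add_re]
    ring
  have hexp2 : (L.quasiPeriodMap ω * (z + ω / 2)).re =
      (z * L.quasiPeriodMap ω).re + 1 / 2 * (ω * L.quasiPeriodMap ω).re := by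
    have : L.quasiPeriodMap ω * (z + ω / 2) = z * L.quasiPeriodMap ω + ((1 / 2 : ℝ) : ℂ) * (ω * L.quasiPeriodMap ω) := by
      push_cast; ring
    rw [this, Complex.add_re, Complex.re_ofReal_mul]
  rw [hexp, hexp2]
  linarith


/-! ### The duplication law (ATAEC I.5.6(b), proof of Thm. VI.3.2) -/

open Filter Topology in
/-- `σ(h)/h → 1` as `h → 0` (`σ'(0) = 1`: `σ(h) = h ∏ E(h, l)` with `∏ E(0, l) = 1` and the product
continuous). [cite: WhittakerWatson1927, §20.42] -/
theorem tendsto_weierstrassSigma_div : Tendsto (fun h : ℂ => L.weierstrassSigma h / h) (𝓝[≠] 0) (𝓝 1) := by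
  have hc : ContinuousAt (fun z : ℂ => ∏' l : L.lattice, sigmaFactor z l) 0 :=
    (L.differentiable_tprod_sigmaFactor 0).continuousAt
  have h1 : Tendsto (fun z : ℂ => ∏' l : L.lattice, sigmaFactor z l) (𝓝[≠] 0) (𝓝 1) := by
    have := hc.tendsto
    rw [L.tprod_sigmaFactor_zero] at this
    exact this.mono_left nhdsWithin_le_nhds
  refine h1.congr' ?_
  filter_upwards [self_mem_nhdsWithin] with h hh
  rw [weierstrassSigma, mul_div_cancel_left₀ _ hh]

/-- `η(2z) = 2η(z)` (`ℝ`-linearity). [folklore] -/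
theorem quasiPeriodMap_two_mul (z : ℂ) : L.quasiPeriodMap (2 * z) = 2 * L.quasiPeriodMap z := by
  have : (2 : ℂ) * z = (2 : ℝ) • z := by simp [two_smul, two_mul]
  rw [this, LinearMap.map_smul]
  simp [two_smul, two_mul]

/-- **The duplication law of the Néron function** (ATAEC, proof of Thm. VI.3.2, property (iii) of
Thm. VI.1.1): for `2z ∉ Λ`,
`λ(2z) = 4λ(z) − log|℘'(z)| + ¼ log|Δ(Λ)|` (from `log|σ(2z)| = 4 log|σ(z)| + log|℘'(z)|` and
`Re(2z η(2z)) = 4 Re(z η(z))`). [cite: Silverman1994, Thm VI.3.2] -/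
theorem neronSigma_two_mul {z : ℂ} (h2z : 2 * z ∉ L.lattice) :
    L.neronSigma (2 * z) =
      4 * L.neronSigma z - Real.log ‖℘'[L] z‖ + 1 / 4 * Real.log ‖L.g₂ ^ 3 - 27 * L.g₃ ^ 2‖ := by
  have hz : z ∉ L.lattice := fun h => h2z (by simpa [two_mul] using add_mem h h)
  have hσz : L.weierstrassSigma z ≠ 0 := L.weierstrassSigma_ne_zero hz
  have hσ2 : L.weierstrassSigma (2 * z) ≠ 0 := L.weierstrassSigma_ne_zero h2z
  have h56 := L.derivWeierstrassP_eq_sigma hz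
  have hlog : Real.log ‖℘'[L] z‖ = Real.log ‖L.weierstrassSigma (2 * z)‖ - 4 * Real.log ‖L.weierstrassSigma z‖ := by
    rw [h56, norm_div, norm_neg, norm_pow, Real.log_div (norm_ne_zero_iff.mpr hσ2)
      (pow_ne_zero 4 (norm_ne_zero_iff.mpr hσz)), Real.log_pow]
    push_cast
    ring
  have hre : (2 * z * L.quasiPeriodMap (2 * z)).re = 4 * (z * L.quasiPeriodMap z).re := by
    rw [quasiPeriodMap_two_mul, show 2 * z * (2 * L.quasiPeriodMap z) = ((4 : ℝ) : ℂ) * (z * L.quasiPeriodMap z) by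
      push_cast; ring, Complex.re_ofReal_mul]
  rw [neronSigma_def, neronSigma_def, hre, hlog]
  ring


/-! ### Continuity of the Néron function off the lattice -/

/-- The quasi-period map is continuous (a linear map on a finite-dimensional space). [folklore] -/
theorem continuous_quasiPeriodMap : Continuous L.quasiPeriodMap :=
  L.quasiPeriodMap.continuous_of_finiteDimensional

/-- The Néron function is continuous off the lattice (ATAEC Thm. VI.3.2: "`λ(z)` is actually a
real-analytic function on `E(ℂ) ∖ {O}`"; here only continuity: `σ` is entire and non-vanishing off
`Λ`). [cite: Silverman1994, Thm VI.3.2] -/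
theorem continuousAt_neronSigma {w : ℂ} (hw : w ∉ L.lattice) : ContinuousAt L.neronSigma w := by
  have hσ : Continuous L.weierstrassSigma := L.differentiable_weierstrassSigma_holds.continuous
  have h1 : ContinuousAt (fun z : ℂ => 1 / 2 * (z * L.quasiPeriodMap z).re) w :=
    continuousAt_const.mul ((Complex.continuous_re.continuousAt).comp
      (continuousAt_id.mul L.continuous_quasiPeriodMap.continuousAt))
  have h2 : ContinuousAt (fun z : ℂ => Real.log ‖L.weierstrassSigma z‖) w :=
    ((continuous_norm.comp hσ).continuousAt).log
      (norm_ne_zero_iff.mpr (L.weierstrassSigma_ne_zero hw))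
  exact (h1.sub h2).sub continuousAt_const

/-! ### Behaviour at the origin -/

open Filter Topology in
/-- Near `0`: `|log|σ(w)| − log|w|| ≤ log 2` (since `σ(w)/w → 1`, `|σ(w)/w| ∈ (½, 3/2)` near `0`).
[folklore] -/
theorem eventually_abs_log_norm_weierstrassSigma_sub_le :
    ∀ᶠ w in 𝓝[≠] (0 : ℂ), |Real.log ‖L.weierstrassSigma w‖ - Real.log ‖w‖| ≤ Real.log 2 := by
  have ht := L.tendsto_weierstrassSigma_div
  have hev : ∀ᶠ w in 𝓝[≠] (0 : ℂ), dist (L.weierstrassSigma w / w) 1 < 1 / 2 :=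
    Metric.tendsto_nhds.mp ht (1 / 2) (by norm_num)
  filter_upwards [hev, self_mem_nhdsWithin] with w hw hw0
  rw [dist_eq_norm] at hw
  have hw0' : ‖w‖ ≠ 0 := norm_ne_zero_iff.mpr hw0
  have hlo : 1 / 2 < ‖L.weierstrassSigma w / w‖ := by
    have := norm_sub_norm_le (1 : ℂ) (L.weierstrassSigma w / w)
    rw [norm_one, norm_sub_rev] at this
    linarith
  have hhi : ‖L.weierstrassSigma w / w‖ < 3 / 2 := by
    have := norm_le_norm_add_norm_sub' (L.weierstrassSigma w / w) (1 : ℂ)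
    rw [norm_one] at this
    have h' : ‖L.weierstrassSigma w / w - 1‖ < 1 / 2 := hw
    linarith [norm_sub_rev (L.weierstrassSigma w / w) 1]
  have hq0 : L.weierstrassSigma w ≠ 0 := by
    intro h0
    rw [h0, zero_div, norm_zero] at hlo
    norm_num at hlo
  have heq : Real.log ‖L.weierstrassSigma w‖ - Real.log ‖w‖ = Real.log ‖L.weierstrassSigma w / w‖ := by
    rw [norm_div, Real.log_div (norm_ne_zero_iff.mpr hq0) hw0']
  rw [heq, abs_le]
  constructor
  · have h1 : Real.log (1 / 2) ≤ Real.log ‖L.weierstrassSigma w / w‖ :=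
      Real.log_le_log (by norm_num) hlo.le
    rw [one_div, Real.log_inv] at h1
    exact h1
  · calc Real.log ‖L.weierstrassSigma w / w‖ ≤ Real.log (3 / 2) :=
          Real.log_le_log (by linarith) hhi.le
      _ ≤ Real.log 2 := Real.log_le_log (by norm_num) (by norm_num)

open Filter Topology in
/-- Near `0`: `|½ log⁺|℘(w) − b| + log|w|| ≤ ½ log 2`: `℘(w) = w⁻² + R(w)` with `R = ℘[L − 0]`
continuous at `0` (Mathlib `PeriodPair.analyticAt_weierstrassPExcept`), so for `w` small
`½|w|⁻² ≤ |℘(w) − b| ≤ (3/2)|w|⁻²` and `log⁺ = log`. This is the statement "`λ + ½v(℘) → ` limit"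
of ATAEC Thm. VI.1.1(a)(ii) for the main term. [cite: Silverman1994, Thm VI.3.2] -/
theorem eventually_abs_posLog_weierstrassP_sub_le (b : ℂ) :
    ∀ᶠ w in 𝓝[≠] (0 : ℂ), |1 / 2 * Real.posLog ‖℘[L] w - b‖ + Real.log ‖w‖| ≤ 1 / 2 * Real.log 2 := by
  -- the regular part `R = ℘ − w⁻²` is continuous at `0`, hence `‖R(w) − b‖ ≤ M` near `0`
  have hR : ContinuousAt (L.weierstrassPExcept 0) 0 := (L.analyticAt_weierstrassPExcept 0).continuousAt
  set M : ℝ := ‖L.weierstrassPExcept 0 0 - b‖ + 1 with hM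
  have hM0 : 0 < M := by positivity
  have hev1 : ∀ᶠ w in 𝓝 (0 : ℂ), ‖L.weierstrassPExcept 0 w - b‖ ≤ M := by
    have := Metric.tendsto_nhds.mp hR.tendsto 1 one_pos
    filter_upwards [this] with w hw
    rw [dist_eq_norm] at hw
    calc ‖L.weierstrassPExcept 0 w - b‖ = ‖(L.weierstrassPExcept 0 w - L.weierstrassPExcept 0 0) + (L.weierstrassPExcept 0 0 - b)‖ := by ring_nf
      _ ≤ ‖L.weierstrassPExcept 0 w - L.weierstrassPExcept 0 0‖ + ‖L.weierstrassPExcept 0 0 - b‖ := norm_add_le _ _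
      _ ≤ M := by rw [hM]; linarith [hw.le]
  have hsq : Tendsto (fun w : ℂ => ‖w‖ ^ 2) (𝓝 0) (𝓝 0) := by
    have hc : Continuous fun w : ℂ => ‖w‖ ^ 2 := continuous_norm.pow 2
    have h := hc.tendsto 0
    simpa using h
  have hev2 : ∀ᶠ w in 𝓝 (0 : ℂ), ‖w‖ ^ 2 ≤ 1 / (2 * M) :=
    hsq.eventually (eventually_le_nhds (by positivity))
  have hev3 : ∀ᶠ w in 𝓝 (0 : ℂ), ‖w‖ ^ 2 ≤ 1 / 2 :=
    hsq.eventually (eventually_le_nhds (by norm_num))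
  filter_upwards [mem_nhdsWithin_of_mem_nhds hev1, mem_nhdsWithin_of_mem_nhds hev2,
    mem_nhdsWithin_of_mem_nhds hev3, self_mem_nhdsWithin] with w hRw hsmall hsmall' hw0
  have hw0' : (0 : ℝ) < ‖w‖ := norm_pos_iff.mpr hw0
  set A : ℝ := 1 / ‖w‖ ^ 2 with hA
  have hA0 : 0 < A := by positivity
  have hnormA : ‖(1 : ℂ) / w ^ 2‖ = A := by rw [norm_div, norm_one, norm_pow]
  have hAM : 2 * M ≤ A := by
    rw [hA, le_div_iff₀ (by positivity)]
    calc 2 * M * ‖w‖ ^ 2 ≤ 2 * M * (1 / (2 * M)) := by gcongr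
      _ = 1 := by field_simp
  have hA2 : 2 ≤ A := by
    rw [hA, le_div_iff₀ (by positivity)]
    linarith
  have hdef : ℘[L] w - b = 1 / w ^ 2 + (L.weierstrassPExcept 0 w - b) := by
    have h := L.weierstrassPExcept_def ⟨0, zero_mem _⟩ w
    simp only [sub_zero, ne_eq, OfNat.ofNat_ne_zero, not_false_eq_true,
      zero_pow, div_zero, zero_sub] at h
    rw [h]
    ring
  have hlo : A / 2 ≤ ‖℘[L] w - b‖ := by
    rw [hdef]
    have := norm_sub_norm_le ((1 : ℂ) / w ^ 2) (-(L.weierstrassPExcept 0 w - b))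
    rw [sub_neg_eq_add, norm_neg, hnormA] at this
    linarith
  have hhi : ‖℘[L] w - b‖ ≤ 3 / 2 * A := by
    rw [hdef]
    calc ‖1 / w ^ 2 + (L.weierstrassPExcept 0 w - b)‖ ≤ ‖(1 : ℂ) / w ^ 2‖ + ‖L.weierstrassPExcept 0 w - b‖ := norm_add_le _ _
      _ ≤ A + M := by rw [hnormA]; linarith
      _ ≤ 3 / 2 * A := by linarith
  have h1 : 1 ≤ ‖℘[L] w - b‖ := by linarith
  have hpos : 0 < ‖℘[L] w - b‖ := by linarith
  rw [Real.posLog_eq_log (by rwa [abs_of_nonneg (norm_nonneg _)])]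
  have hlogA : Real.log A = -(2 * Real.log ‖w‖) := by
    rw [hA, one_div, Real.log_inv, Real.log_pow]
    push_cast
    ring
  have hl1 : Real.log (A / 2) ≤ Real.log ‖℘[L] w - b‖ := Real.log_le_log (by positivity) hlo
  have hl2 : Real.log ‖℘[L] w - b‖ ≤ Real.log (3 / 2 * A) := Real.log_le_log hpos hhi
  rw [Real.log_div hA0.ne' two_ne_zero, hlogA] at hl1
  rw [Real.log_mul (by norm_num) hA0.ne', hlogA] at hl2
  have h32 : Real.log (3 / 2) ≤ Real.log 2 := Real.log_le_log (by norm_num) (by norm_num)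
  rw [abs_le]
  constructor <;> linarith

open Filter Topology in
/-- Near `0` the combination `½ log⁺|℘(w) − b| − λ(w)` stays bounded (by
`½ log 2 + 1 + log 2 + |(1/12) log|Δ(Λ)||`): the two logarithmic singularities `−log|w|` of
`½ log⁺|℘ − b|` and `+log|w|` of `−log|σ|` cancel, and `½Re(wη(w)) → 0`.
[cite: Silverman1994, Thm VI.3.2] -/
theorem exists_eventually_abs_posLog_sub_neronSigma_le (b : ℂ) :
    ∃ B₀ : ℝ, ∀ᶠ w in 𝓝[≠] (0 : ℂ), |1 / 2 * Real.posLog ‖℘[L] w - b‖ - L.neronSigma w| ≤ B₀ := by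
  have hη : Tendsto (fun w : ℂ => 1 / 2 * (w * L.quasiPeriodMap w).re) (𝓝 0) (𝓝 0) := by
    have hc : Continuous fun w : ℂ => 1 / 2 * (w * L.quasiPeriodMap w).re :=
      continuous_const.mul (Complex.continuous_re.comp (continuous_id.mul L.continuous_quasiPeriodMap))
    have := hc.continuousAt.tendsto (x := (0 : ℂ))
    simpa using this
  have hevη : ∀ᶠ w in 𝓝[≠] (0 : ℂ), |1 / 2 * (w * L.quasiPeriodMap w).re| ≤ 1 := by
    have := Metric.tendsto_nhds.mp hη 1 one_pos
    refine mem_nhdsWithin_of_mem_nhds (this.mono fun w hw => ?_)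
    rw [Real.dist_eq, sub_zero] at hw
    exact hw.le
  refine ⟨1 / 2 * Real.log 2 + 1 + Real.log 2 + |1 / 12 * Real.log ‖L.g₂ ^ 3 - 27 * L.g₃ ^ 2‖|, ?_⟩
  filter_upwards [L.eventually_abs_log_norm_weierstrassSigma_sub_le,
    L.eventually_abs_posLog_weierstrassP_sub_le b, hevη] with w h1 h2 h3
  rw [neronSigma_def]
  have key : 1 / 2 * Real.posLog ‖℘[L] w - b‖ -
      (1 / 2 * (w * L.quasiPeriodMap w).re - Real.log ‖L.weierstrassSigma w‖ -
        1 / 12 * Real.log ‖L.g₂ ^ 3 - 27 * L.g₃ ^ 2‖) =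
      (1 / 2 * Real.posLog ‖℘[L] w - b‖ + Real.log ‖w‖) - 1 / 2 * (w * L.quasiPeriodMap w).re +
        (Real.log ‖L.weierstrassSigma w‖ - Real.log ‖w‖) +
        1 / 12 * Real.log ‖L.g₂ ^ 3 - 27 * L.g₃ ^ 2‖ := by ring
  rw [key]
  have hc : |1 / 12 * Real.log ‖L.g₂ ^ 3 - 27 * L.g₃ ^ 2‖| ≤ |1 / 12 * Real.log ‖L.g₂ ^ 3 - 27 * L.g₃ ^ 2‖| := le_rfl
  calc _ ≤ |1 / 2 * Real.posLog ‖℘[L] w - b‖ + Real.log ‖w‖| + |1 / 2 * (w * L.quasiPeriodMap w).re| +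
        |Real.log ‖L.weierstrassSigma w‖ - Real.log ‖w‖| + |1 / 12 * Real.log ‖L.g₂ ^ 3 - 27 * L.g₃ ^ 2‖| := by
          refine (abs_add_le _ _).trans (add_le_add ?_ le_rfl)
          refine (abs_add_le _ _).trans (add_le_add ?_ le_rfl)
          exact abs_sub _ _
    _ ≤ _ := by linarith

/-! ### Global boundedness of `½ log⁺|℘ − b| − λ` (ATAEC VI.1.1(a)(ii) for the `σ`-form) -/

open Filter Topology Metric in
/-- **`½ log⁺|℘(w) − b| − λ(w)` is bounded on `ℂ ∖ Λ`** (for any constant `b`): near lattice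
points by the local analysis at `0` and periodicity, elsewhere by continuity on a compact
fundamental domain. This is the `σ`-form of properties (i)–(ii) of Tate's characterisation
(ATAEC Thm. VI.1.1(a)) for the function of Thm. VI.3.2, with `x = ℘ − b`.
[cite: Silverman1994, Thm VI.3.2] -/
theorem exists_bound_posLog_sub_neronSigma (b : ℂ) :
    ∃ B : ℝ, ∀ w : ℂ, w ∉ L.lattice →
      |1 / 2 * Real.posLog ‖℘[L] w - b‖ - L.neronSigma w| ≤ B := by
  set H : ℂ → ℝ := fun w => 1 / 2 * Real.posLog ‖℘[L] w - b‖ - L.neronSigma w with hH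
  -- periodicity
  have hper : ∀ w : ℂ, w ∉ L.lattice → ∀ ℓ : ℂ, ℓ ∈ L.lattice → H (w + ℓ) = H w := by
    intro w hw ℓ hℓ
    simp only [hH, L.neronSigma_add_of_mem hℓ hw, L.weierstrassP_add_coe w ⟨ℓ, hℓ⟩]
  -- continuity off the lattice
  have hcontAt : ∀ w : ℂ, w ∉ L.lattice → ContinuousAt H w := by
    intro w hw
    have hopen : IsOpen ((L.lattice : Set ℂ)ᶜ) := L.isClosed_lattice.isOpen_compl
    have h℘ : ContinuousAt ℘[L] w :=
      (L.differentiableOn_weierstrassP.differentiableAt (hopen.mem_nhds hw)).continuousAt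
    exact (continuousAt_const.mul (Real.continuous_posLog.continuousAt.comp
      (continuous_norm.continuousAt.comp (h℘.sub continuousAt_const)))).sub
      (L.continuousAt_neronSigma hw)
  -- near the origin
  obtain ⟨B₀, hB₀⟩ := L.exists_eventually_abs_posLog_sub_neronSigma_le b
  obtain ⟨δ, hδ, hδB⟩ : ∃ δ > 0, ∀ w : ℂ, w ≠ 0 → ‖w‖ < δ → |H w| ≤ B₀ := by
    rw [eventually_nhdsWithin_iff, Metric.eventually_nhds_iff] at hB₀
    obtain ⟨δ, hδ, h⟩ := hB₀
    exact ⟨δ, hδ, fun w hw0 hw => h (by simpa using hw) hw0⟩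
  -- the compact part
  set R : ℝ := ‖L.ω₁‖ + ‖L.ω₂‖ with hR
  set K : Set ℂ := closedBall 0 R ∩ {w | ∀ ℓ : ℂ, ℓ ∈ L.lattice → δ ≤ ‖w - ℓ‖} with hK
  have hKclosed : IsClosed {w : ℂ | ∀ ℓ : ℂ, ℓ ∈ L.lattice → δ ≤ ‖w - ℓ‖} := by
    have : {w : ℂ | ∀ ℓ : ℂ, ℓ ∈ L.lattice → δ ≤ ‖w - ℓ‖} = ⋂ ℓ ∈ (L.lattice : Set ℂ), {w | δ ≤ ‖w - ℓ‖} := by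
      ext w; simp
    rw [this]
    exact isClosed_biInter fun ℓ _ => isClosed_le continuous_const (continuous_id.sub continuous_const).norm
  have hKc : IsCompact K := (isCompact_closedBall 0 R).inter_right hKclosed
  have hKΛ : ∀ w ∈ K, w ∉ L.lattice := by
    intro w hw hwΛ
    have := hw.2 w hwΛ
    simp only [sub_self, norm_zero] at this
    linarith
  have hcont : ContinuousOn H K := fun w hw => (hcontAt w (hKΛ w hw)).continuousWithinAt
  obtain ⟨B₁, hB₁⟩ := hKc.exists_bound_of_continuousOn hcont
  refine ⟨max B₀ B₁, fun w hw => ?_⟩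
  -- reduce `w` modulo `Λ` into the closed ball of radius `R`
  obtain ⟨C₀, -, hred⟩ := L.exists_eq_add_int_mul_add_int_mul
  obtain ⟨m, n, w₀, hw₀eq, hw₀R, -, -⟩ := hred w
  have hℓ : (m : ℂ) * L.ω₁ + n * L.ω₂ ∈ L.lattice := mem_lattice.mpr ⟨m, n, rfl⟩
  have hw₀Λ : w₀ ∉ L.lattice := by
    intro h0
    apply hw
    rw [hw₀eq, add_assoc]
    exact add_mem h0 hℓ
  have hHw : H w = H w₀ := by
    rw [hw₀eq, add_assoc]
    exact hper w₀ hw₀Λ _ hℓ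
  show |H w| ≤ max B₀ B₁
  rw [hHw]
  by_cases hnear : ∃ ℓ : ℂ, ℓ ∈ L.lattice ∧ ‖w₀ - ℓ‖ < δ
  · obtain ⟨ℓ, hℓΛ, hd⟩ := hnear
    have hmem : w₀ - ℓ ∉ L.lattice := fun h0 => hw₀Λ (by simpa using add_mem h0 hℓΛ)
    have hne : w₀ - ℓ ≠ 0 := fun h0 => hmem (h0 ▸ zero_mem _)
    have : H w₀ = H (w₀ - ℓ) := by
      conv_lhs => rw [show w₀ = (w₀ - ℓ) + ℓ by ring]
      exact hper (w₀ - ℓ) hmem ℓ hℓΛ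
    rw [this]
    exact (hδB _ hne hd).trans (le_max_left _ _)
  · push Not at hnear
    have hK' : w₀ ∈ K := ⟨mem_closedBall.mpr (by simpa using hw₀R), fun ℓ hℓ => hnear ℓ hℓ⟩
    have := hB₁ w₀ hK'
    rw [Real.norm_eq_abs] at this
    exact this.trans (le_max_right _ _)

end PeriodPair

end
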